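import Mathlib
import Literature.Analysis.PDE.Wave1DNearChannelLemmas
import Literature.Analysis.PDE.Wave1DDuhamelBound
import Literature.Analysis.PDE.DAlembert1D
import HarnessLib

/-!
# Near-edge channel of energy, II: the forward lower bound for `ψ_tt − ψ_xx + V(x)ψ = 0` with an
# exponentially small potential

Analysis/PDE support file (everything proved). The perturbative half of a channel-of-energy
estimate on the LEFT of a receding edge `a − |t|` when the potential is small there in the
Volterra/Duhamel sense, `0 ≤ V(x) ≤ K e^{μ(x − a)}` for `x ≤ a` (`μ > 0`): the situation of the
horizon side of the Regge–Wheeler equation (route PhotonSphereChannels, item `FixedModeChannels`,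
stmt-FinalStateConjecture-10048, where `V = O(e^{x/2M})`, `μ = 1/2M`, `K = B e^{−ρ/2M}`).

`wave1D_near_liminf_ge`: let `ψ = φ + q` with `φ` a global `C²` solution (think `φ = ψ − βU`, `U` the
recessive static solution) and `q` a static `C¹` function with `∫_{−∞}^a q'² < ∞`; let
`h = φ(0,·)`, `g = ∂_t φ(0,·)` have finite `V`-energy `EV = ∫_{−∞}^a (g² + h'² + Vh²)`. Then for every
`η > 0`

  `liminf_{t→+∞} ∫⁻_{x < a−|t|} (ψ_t² + ψ_x² + Vψ²)(t,·) ≥ (∫_{−∞}^a (h' + g)²/2)/(1+η)² − 4σ² EV/(η(1+η))`,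
  `σ = 2√K/μ`.

Mechanism: `φ = φ₀ + w` with `φ₀ = F(x−t) + G(x+t)` the free evolution of `(h, g)`
(`DAlembert1D.lean`; `2G' = h' + g`) and `w` the solution of the FREE equation with source `−Vφ`
and zero data; on every truncated trapezoid `{b + τ ≤ x ≤ a − τ}` the Duhamel bound
(`Wave1DDuhamelBound.lean`) and `sup_{x ≤ a−τ} V ≤ K e^{−μτ}` give `E⁰[w](t) ≤ 4σ² EV`, the free
energy dominates the left-mover `2∫_{b+2t}^a G'²`, the static part contributes `−(1/η)∫_{x<a−t} q'² → 0`,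
and the pointwise inequality `(u + v)² ≥ u²/(1+η) − v²/η` glues the three; finally `b → −∞`.
The time-reversed statement (apply to `ψ(−t,·)`) has `(h' − g)²` in place of `(h' + g)²`; the two add
up to `h'² + g²`, the free energy of the data.

Folklore in method (Duyckaerts–Kenig–Merle perturbative channel arguments); no single source.
-/

noncomputable section

namespace Literature.Analysis.PDE

open MeasureTheory Set Filter Topology intervalIntegral Literature.Analysis.Calculus

section Forward

variable {V : ℝ → ℝ} {ψ φ : ℝ → ℝ → ℝ} {q : ℝ → ℝ}

/-- **Near-edge forward channel lower bound** (see the module docstring). [folklore] -/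
theorem wave1D_near_liminf_ge (hV : Continuous V) (hV0 : ∀ x, 0 ≤ V x) {a K μ : ℝ} (hK : 0 ≤ K)
    (hμ : 0 < μ) (hVK : ∀ x ≤ a, V x ≤ K * Real.exp (μ * (x - a)))
    (hψ : ContDiff ℝ 2 (Function.uncurry ψ))
    (hφ : ContDiff ℝ 2 (Function.uncurry φ))
    (hφsol : ∀ t x, iteratedDeriv 2 (fun τ => φ τ x) t - iteratedDeriv 2 (φ t) x + V x * φ t x = 0)
    (hq : ContDiff ℝ 1 q) (hψφ : ∀ t x, ψ t x = φ t x + q x)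
    (hqi : IntegrableOn (fun x => deriv q x ^ 2) (Iic a))
    (hEi : IntegrableOn (fun x => deriv (fun τ => φ τ x) 0 ^ 2 + deriv (φ 0) x ^ 2
      + V x * φ 0 x ^ 2) (Iic a))
    {η : ℝ} (hη : 0 < η) :
    ENNReal.ofReal ((∫ x in Iic a, (deriv (φ 0) x + deriv (fun τ => φ τ x) 0) ^ 2 / 2) / (1 + η) ^ 2
        - 4 * (2 * Real.sqrt K / μ) ^ 2 * (∫ x in Iic a, (deriv (fun τ => φ τ x) 0 ^ 2
          + deriv (φ 0) x ^ 2 + V x * φ 0 x ^ 2)) / (η * (1 + η)))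
      ≤ liminf (fun t => ∫⁻ x in Iio (a - |t|), ENNReal.ofReal
          (deriv (fun τ => ψ τ x) t ^ 2 + deriv (ψ t) x ^ 2 + V x * ψ t x ^ 2)) atTop := by
  -- names for the constants
  set EV : ℝ := ∫ x in Iic a, (deriv (fun τ => φ τ x) 0 ^ 2 + deriv (φ 0) x ^ 2
    + V x * φ 0 x ^ 2) with hEV
  set σ : ℝ := 2 * Real.sqrt K / μ with hσ
  have hη1 : 0 < 1 + η := by linarith
  -- partial derivatives of `φ`
  obtain ⟨φt, φx, φtt, φtx, φxx, hct, hcx, -, hctx, -, h1, h2, -, -, h5, -, -, -⟩ :=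
    exists_partials_of_contDiff_two hφ
  have hd1 : ∀ t x, deriv (fun τ => φ τ x) t = φt t x := fun t x => (h1 t x).deriv
  have hd2 : ∀ t x, deriv (φ t) x = φx t x := fun t x => (h2 t x).deriv
  -- data
  set h : ℝ → ℝ := φ 0 with hh
  set g : ℝ → ℝ := fun x => φt 0 x with hg
  have hhC2 : ContDiff ℝ 2 h := (contDiff_two_slices hφ 0 0).2
  have hgC1 : ContDiff ℝ 1 g := by
    rw [show (1 : WithTop ℕ∞) = 0 + 1 by norm_num, contDiff_succ_iff_deriv]
    refine ⟨fun x => (h5 0 x).differentiableAt, fun h' => absurd h' (by simp), ?_⟩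
    have : deriv g = fun x => φtx 0 x := funext fun x => (h5 0 x).deriv
    rw [this]
    exact contDiff_zero.2 (hctx.comp (continuous_const.prodMk continuous_id))
  have hg_eq : ∀ x, deriv (fun τ => φ τ x) 0 = g x := fun x => hd1 0 x
  -- the free evolution of the data
  obtain ⟨φ₀, F, G, hφ₀C2, hFC2, hGC2, -, hFG, hGF', hFG', -, hφ₀sol, hφ₀0, hφ₀t0, hφ₀t, hφ₀x, hφ₀e⟩
    := exists_dAlembert_solution hhC2 hgC1
  have hG' : ∀ x, deriv G x = (deriv h x + g x) / 2 := by
    intro x; have e1 := hGF' x; have e2 := hFG' x; linarith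
  -- the perturbation `w = φ − φ₀`: free equation with source `−Vφ`, zero data
  set w : ℝ → ℝ → ℝ := fun t x => φ t x - φ₀ t x with hw
  have hwC2 : ContDiff ℝ 2 (Function.uncurry w) := hφ.sub hφ₀C2
  set Fw : ℝ → ℝ → ℝ := fun t x => -(V x * φ t x) with hFw
  have hFw_cont : Continuous (Function.uncurry Fw) := by
    show Continuous fun p : ℝ × ℝ => -(V p.2 * φ p.1 p.2)
    exact ((hV.comp continuous_snd).mul hφ.continuous).neg
  have hwsol : ∀ t x, iteratedDeriv 2 (fun τ => w τ x) t - iteratedDeriv 2 (w t) x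
      + (fun _ => (0 : ℝ)) x * w t x = Fw t x := by
    intro t x
    have s1 := (contDiff_two_slices hφ t x)
    have s2 := (contDiff_two_slices hφ₀C2 t x)
    have e1 : iteratedDeriv 2 (fun τ => w τ x) t
        = iteratedDeriv 2 (fun τ => φ τ x) t - iteratedDeriv 2 (fun τ => φ₀ τ x) t :=
      iteratedDeriv_fun_sub (n := 2) s1.1.contDiffAt s2.1.contDiffAt
    have e2 : iteratedDeriv 2 (w t) x = iteratedDeriv 2 (φ t) x - iteratedDeriv 2 (φ₀ t) x :=
      iteratedDeriv_fun_sub (n := 2) s1.2.contDiffAt s2.2.contDiffAt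
    have e3 := hφsol t x
    have e4 := hφ₀sol t x
    simp only [hFw, zero_mul, add_zero]
    rw [e1, e2]
    linarith
  have hwzero : ∀ x, w 0 x = 0 ∧ deriv (fun τ => w τ x) 0 = 0 := by
    intro x
    refine ⟨by simp only [hw, hφ₀0, hh, sub_self], ?_⟩
    have hdw : deriv (fun τ => w τ x) 0 = deriv (fun τ => φ τ x) 0 - deriv (fun τ => φ₀ τ x) 0 := by
      apply deriv_fun_sub (h1 0 x).differentiableAt
      exact ((contDiff_two_slices hφ₀C2 0 x).1.differentiable (by norm_num) 0)
    rw [hdw, hg_eq, hφ₀t0]; ring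
  -- `ψ` in terms of `φ` and `q`
  have hqd : Differentiable ℝ q := hq.differentiable (by norm_num)
  have hqc' : Continuous (deriv q) := hq.continuous_deriv le_rfl
  have hψt_eq : ∀ t x, deriv (fun τ => ψ τ x) t = deriv (fun τ => φ τ x) t := by
    intro t x
    have : (fun τ => ψ τ x) = fun τ => φ τ x + q x := funext fun τ => hψφ τ x
    rw [this, deriv_add_const]
  have hψx_eq : ∀ t x, deriv (ψ t) x = deriv (φ t) x + deriv q x := by
    intro t x
    have : ψ t = fun y => φ t y + q y := funext fun y => hψφ t y
    rw [this]
    exact deriv_fun_add (h2 t x).differentiableAt (hqd x)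
  -- integrability of the data densities on `Iic a`
  have hdens_c : Continuous fun x => deriv (fun τ => φ τ x) 0 ^ 2 + deriv (φ 0) x ^ 2
      + V x * φ 0 x ^ 2 :=
    (continuous_wave1D_energyDensity hV hφ).comp (continuous_const.prodMk continuous_id)
  have hdens_nn : ∀ x, 0 ≤ deriv (fun τ => φ τ x) 0 ^ 2 + deriv (φ 0) x ^ 2 + V x * φ 0 x ^ 2 :=
    fun x => wave1D_energyDensity_nonneg hV0 0 x
  have hEV0 : 0 ≤ EV := setIntegral_nonneg measurableSet_Iic fun x _ => hdens_nn x
  have hG'c : Continuous (deriv G) := hGC2.continuous_deriv (by norm_num)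
  have hG'sq_le : ∀ x, 2 * deriv G x ^ 2 ≤ deriv (fun τ => φ τ x) 0 ^ 2 + deriv (φ 0) x ^ 2
      + V x * φ 0 x ^ 2 := by
    intro x
    rw [hG', hg_eq]
    have := hV0 x
    nlinarith [sq_nonneg (deriv h x - g x), mul_nonneg this (sq_nonneg (φ 0 x))]
  have hG'i : IntegrableOn (fun x => 2 * deriv G x ^ 2) (Iic a) :=
    Integrable.mono' hEi ((hG'c.pow 2).const_mul 2).aestronglyMeasurable
      (Eventually.of_forall fun x => by
        rw [Real.norm_eq_abs, abs_of_nonneg (by positivity)]; exact hG'sq_le x)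
  -- the main constant
  set IG : ℝ := ∫ x in Iic a, 2 * deriv G x ^ 2 with hIG
  have hIG_eq : (∫ x in Iic a, (deriv (φ 0) x + deriv (fun τ => φ τ x) 0) ^ 2 / 2) = IG := by
    refine setIntegral_congr_fun measurableSet_Iic fun x _ => ?_
    rw [hG', hg_eq]; ring
  set Uq : ℝ → ℝ := fun t => ∫ x in Iic (a - t), deriv q x ^ 2 with hUq
  set X : ℝ := IG / (1 + η) ^ 2 - 4 * σ ^ 2 * EV / (η * (1 + η)) with hX
  -- STEP 1: the bound at a fixed time `t ≥ 0` on a truncated trapezoid `[b + t, a - t]`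
  have hstep : ∀ t : ℝ, 0 ≤ t → ∀ b : ℝ, b + 2 * t ≤ a →
      (2 * ∫ x in (b + 2 * t)..a, deriv G x ^ 2) / (1 + η) ^ 2 - 4 * σ ^ 2 * EV / (η * (1 + η))
        - Uq t / η
      ≤ ∫ x in (b + t)..(a - t),
          (deriv (fun τ => ψ τ x) t ^ 2 + deriv (ψ t) x ^ 2 + V x * ψ t x ^ 2) := by
    intro t ht b hb
    have hbt : b + t ≤ a - t := by linarith
    -- (i) Duhamel bound for `w` on the trapezoid with base `[b, a]`
    have hDuh := wave1D_trapezoid_energy_le_of_zero_data (V := fun _ => (0 : ℝ)) (F := Fw) (ψ := w)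
      continuous_const (fun _ => le_rfl) hFw_cont hwC2 hwsol (a := b) (b := a)
      (fun x _ => hwzero x) ht hbt
    -- (ii)+(iii) source smallness: `∫_0^t √(∫ (Vφ)²) ≤ σ √EV`
    have hkint : (∫ τ in (0 : ℝ)..t, Real.sqrt (∫ x in (b + τ)..(a - τ), Fw τ x ^ 2))
        ≤ σ * Real.sqrt EV :=
      wave1D_integral_sqrt_source_sq_le hV hV0 hK hμ hVK hφ hφsol hEi ht hbt
    have hEw : (∫ x in (b + t)..(a - t), (deriv (fun τ => w τ x) t ^ 2 + deriv (w t) x ^ 2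
        + (fun _ => (0 : ℝ)) x * w t x ^ 2)) ≤ 4 * σ ^ 2 * EV := by
      refine hDuh.trans ?_
      have h0 : 0 ≤ ∫ τ in (0 : ℝ)..t, Real.sqrt (∫ x in (b + τ)..(a - τ), Fw τ x ^ 2) :=
        intervalIntegral.integral_nonneg ht fun τ _ => Real.sqrt_nonneg _
      calc 4 * (∫ τ in (0 : ℝ)..t, Real.sqrt (∫ x in (b + τ)..(a - τ), Fw τ x ^ 2)) ^ 2
          ≤ 4 * (σ * Real.sqrt EV) ^ 2 := by
            have := pow_le_pow_left₀ h0 hkint 2; nlinarith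
        _ = 4 * σ ^ 2 * EV := by rw [mul_pow, Real.sq_sqrt hEV0]; ring
    -- (iv) the free part dominates the left mover
    have hfree := dAlembert_intervalEnergy_ge_left_mover hGC2 hFC2 hφ₀e t hbt
    rw [show b + t + t = b + 2 * t by ring, show a - t + t = a by ring] at hfree
    -- (v)+(vi) pointwise Peter–Paul and integration over `[b + t, a - t]`
    have hφ₀d : ∀ x, DifferentiableAt ℝ (fun τ => φ₀ τ x) t ∧ DifferentiableAt ℝ (φ₀ t) x := fun x =>
      ⟨(contDiff_two_slices hφ₀C2 t x).1.differentiable (by norm_num) t,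
        (contDiff_two_slices hφ₀C2 t x).2.differentiable (by norm_num) x⟩
    have hwt : ∀ x, deriv (fun τ => w τ x) t = deriv (fun τ => φ τ x) t - deriv (fun τ => φ₀ τ x) t :=
      fun x => deriv_fun_sub (h1 t x).differentiableAt (hφ₀d x).1
    have hwx : ∀ x, deriv (w t) x = deriv (φ t) x - deriv (φ₀ t) x :=
      fun x => deriv_fun_sub (h2 t x).differentiableAt (hφ₀d x).2
    have hpt : ∀ x,
        (deriv (fun τ => φ₀ τ x) t ^ 2 + deriv (φ₀ t) x ^ 2) / (1 + η) ^ 2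
          - (deriv (fun τ => w τ x) t ^ 2 + deriv (w t) x ^ 2 + (fun _ => (0 : ℝ)) x * w t x ^ 2)
            / (η * (1 + η))
          - deriv q x ^ 2 / η
        ≤ deriv (fun τ => ψ τ x) t ^ 2 + deriv (ψ t) x ^ 2 + V x * ψ t x ^ 2 := by
      intro x
      rw [hψt_eq, hψx_eq, hwt, hwx]
      set P := deriv (fun τ => φ τ x) t
      set Qx := deriv (φ t) x
      set R := deriv q x
      set P0 := deriv (fun τ => φ₀ τ x) t
      set Q0 := deriv (φ₀ t) x
      have i1 : Qx ^ 2 / (1 + η) - R ^ 2 / η ≤ (Qx + R) ^ 2 := add_sq_ge_div_sub_div Qx R hη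
      have i2 : P0 ^ 2 / (1 + η) - (P - P0) ^ 2 / η ≤ P ^ 2 := by
        have := add_sq_ge_div_sub_div P0 (P - P0) hη; rwa [add_sub_cancel] at this
      have i3 : Q0 ^ 2 / (1 + η) - (Qx - Q0) ^ 2 / η ≤ Qx ^ 2 := by
        have := add_sq_ge_div_sub_div Q0 (Qx - Q0) hη; rwa [add_sub_cancel] at this
      have i4 : 0 ≤ V x * ψ t x ^ 2 := mul_nonneg (hV0 x) (sq_nonneg _)
      have i5 : P ^ 2 / (1 + η) ≤ P ^ 2 := div_le_self (sq_nonneg _) (by linarith)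
      simp only [zero_mul, add_zero]
      -- combine: target ≥ P² + (Qx+R)²
      have key : (P0 ^ 2 + Q0 ^ 2) / (1 + η) ^ 2 - ((P - P0) ^ 2 + (Qx - Q0) ^ 2) / (η * (1 + η))
          - R ^ 2 / η ≤ P ^ 2 + (Qx + R) ^ 2 := by
        have hsum : (P0 ^ 2 + Q0 ^ 2) / (1 + η) - ((P - P0) ^ 2 + (Qx - Q0) ^ 2) / η
            ≤ P ^ 2 + Qx ^ 2 := by
          have := add_le_add i2 i3
          have e : P0 ^ 2 / (1 + η) - (P - P0) ^ 2 / η + (Q0 ^ 2 / (1 + η) - (Qx - Q0) ^ 2 / η)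
              = (P0 ^ 2 + Q0 ^ 2) / (1 + η) - ((P - P0) ^ 2 + (Qx - Q0) ^ 2) / η := by ring
          linarith
        -- divide `hsum` by `1 + η` and use `i1`, `i5`
        have hdiv : ((P0 ^ 2 + Q0 ^ 2) / (1 + η) - ((P - P0) ^ 2 + (Qx - Q0) ^ 2) / η) / (1 + η)
            ≤ (P ^ 2 + Qx ^ 2) / (1 + η) := div_le_div_of_nonneg_right hsum hη1.le
        have e1 : ((P0 ^ 2 + Q0 ^ 2) / (1 + η) - ((P - P0) ^ 2 + (Qx - Q0) ^ 2) / η) / (1 + η)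
            = (P0 ^ 2 + Q0 ^ 2) / (1 + η) ^ 2 - ((P - P0) ^ 2 + (Qx - Q0) ^ 2) / (η * (1 + η)) := by
          field_simp
        have e2 : (P ^ 2 + Qx ^ 2) / (1 + η) = P ^ 2 / (1 + η) + Qx ^ 2 / (1 + η) := by ring
        rw [e1] at hdiv; rw [e2] at hdiv
        linarith
      linarith
    -- integrate the pointwise inequality
    have cψ : Continuous fun x => deriv (fun τ => ψ τ x) t ^ 2 + deriv (ψ t) x ^ 2 + V x * ψ t x ^ 2 :=
      (continuous_wave1D_energyDensity hV hψ).comp (continuous_const.prodMk continuous_id)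
    have cφ₀ : Continuous fun x => deriv (fun τ => φ₀ τ x) t ^ 2 + deriv (φ₀ t) x ^ 2 := by
      have := (continuous_wave1D_energyDensity (V := fun _ => (0 : ℝ)) continuous_const hφ₀C2).comp
        ((continuous_const (y := t)).prodMk continuous_id)
      simpa [Function.comp_def] using this
    have cw : Continuous fun x => deriv (fun τ => w τ x) t ^ 2 + deriv (w t) x ^ 2
        + (fun _ => (0 : ℝ)) x * w t x ^ 2 :=
      (continuous_wave1D_energyDensity (V := fun _ => (0 : ℝ)) continuous_const hwC2).comp
        (continuous_const.prodMk continuous_id)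
    have cq2 : Continuous fun x => deriv q x ^ 2 := hqc'.pow 2
    have i1 : IntervalIntegrable (fun x => (deriv (fun τ => φ₀ τ x) t ^ 2 + deriv (φ₀ t) x ^ 2)
        / (1 + η) ^ 2) volume (b + t) (a - t) := (cφ₀.div_const _).intervalIntegrable _ _
    have i2 : IntervalIntegrable (fun x => (deriv (fun τ => w τ x) t ^ 2 + deriv (w t) x ^ 2
        + (fun _ => (0 : ℝ)) x * w t x ^ 2) / (η * (1 + η))) volume (b + t) (a - t) :=
      (cw.div_const _).intervalIntegrable _ _
    have i3 : IntervalIntegrable (fun x => deriv q x ^ 2 / η) volume (b + t) (a - t) :=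
      (cq2.div_const _).intervalIntegrable _ _
    have i12 : IntervalIntegrable (fun x => (deriv (fun τ => φ₀ τ x) t ^ 2 + deriv (φ₀ t) x ^ 2)
        / (1 + η) ^ 2 - (deriv (fun τ => w τ x) t ^ 2 + deriv (w t) x ^ 2
        + (fun _ => (0 : ℝ)) x * w t x ^ 2) / (η * (1 + η))) volume (b + t) (a - t) := i1.sub i2
    have hint : (∫ x in (b + t)..(a - t),
        ((deriv (fun τ => φ₀ τ x) t ^ 2 + deriv (φ₀ t) x ^ 2) / (1 + η) ^ 2
          - (deriv (fun τ => w τ x) t ^ 2 + deriv (w t) x ^ 2 + (fun _ => (0 : ℝ)) x * w t x ^ 2)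
            / (η * (1 + η))
          - deriv q x ^ 2 / η))
        ≤ ∫ x in (b + t)..(a - t),
          (deriv (fun τ => ψ τ x) t ^ 2 + deriv (ψ t) x ^ 2 + V x * ψ t x ^ 2) :=
      intervalIntegral.integral_mono_on hbt (i12.sub i3) (cψ.intervalIntegrable _ _) fun x _ => hpt x
    have hsplit : (∫ x in (b + t)..(a - t),
        ((deriv (fun τ => φ₀ τ x) t ^ 2 + deriv (φ₀ t) x ^ 2) / (1 + η) ^ 2
          - (deriv (fun τ => w τ x) t ^ 2 + deriv (w t) x ^ 2 + (fun _ => (0 : ℝ)) x * w t x ^ 2)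
            / (η * (1 + η))
          - deriv q x ^ 2 / η))
        = (∫ x in (b + t)..(a - t), (deriv (fun τ => φ₀ τ x) t ^ 2 + deriv (φ₀ t) x ^ 2))
            / (1 + η) ^ 2
          - (∫ x in (b + t)..(a - t), (deriv (fun τ => w τ x) t ^ 2 + deriv (w t) x ^ 2
            + (fun _ => (0 : ℝ)) x * w t x ^ 2)) / (η * (1 + η))
          - (∫ x in (b + t)..(a - t), deriv q x ^ 2) / η := by
      rw [intervalIntegral.integral_sub i12 i3, intervalIntegral.integral_sub i1 i2,
        intervalIntegral.integral_div, intervalIntegral.integral_div, intervalIntegral.integral_div]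
    rw [hsplit] at hint
    -- the static tail `∫_{b+t}^{a-t} q'² ≤ Uq t`
    have hUq_ge : (∫ x in (b + t)..(a - t), deriv q x ^ 2) ≤ Uq t := by
      rw [intervalIntegral.integral_of_le hbt, hUq]
      exact setIntegral_mono_set (hqi.mono_set (Iic_subset_Iic.2 (by linarith)))
        (ae_of_all _ fun x => sq_nonneg _) (ae_of_all _ Ioc_subset_Iic_self)
    have hA : (2 * ∫ x in (b + 2 * t)..a, deriv G x ^ 2) / (1 + η) ^ 2
        ≤ (∫ x in (b + t)..(a - t), (deriv (fun τ => φ₀ τ x) t ^ 2 + deriv (φ₀ t) x ^ 2))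
          / (1 + η) ^ 2 := div_le_div_of_nonneg_right hfree (by positivity)
    have hB : (∫ x in (b + t)..(a - t), (deriv (fun τ => w τ x) t ^ 2 + deriv (w t) x ^ 2
        + (fun _ => (0 : ℝ)) x * w t x ^ 2)) / (η * (1 + η)) ≤ 4 * σ ^ 2 * EV / (η * (1 + η)) :=
      div_le_div_of_nonneg_right hEw (by positivity)
    have hC : (∫ x in (b + t)..(a - t), deriv q x ^ 2) / η ≤ Uq t / η :=
      div_le_div_of_nonneg_right hUq_ge hη.le
    linarith
  -- STEP 2: `b → −∞` at fixed `t ≥ 0`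
  have hEn_ge : ∀ t : ℝ, 0 ≤ t → ENNReal.ofReal (X - Uq t / η)
      ≤ ∫⁻ x in Iio (a - |t|), ENNReal.ofReal
          (deriv (fun τ => ψ τ x) t ^ 2 + deriv (ψ t) x ^ 2 + V x * ψ t x ^ 2) := by
    intro t ht
    have hlim : Tendsto (fun b : ℝ => (2 * ∫ x in (b + 2 * t)..a, deriv G x ^ 2) / (1 + η) ^ 2
        - 4 * σ ^ 2 * EV / (η * (1 + η)) - Uq t / η) atBot (𝓝 (X - Uq t / η)) := by
      have hI : Tendsto (fun b : ℝ => ∫ x in (b + 2 * t)..a, 2 * deriv G x ^ 2) atBot (𝓝 IG) :=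
        intervalIntegral_tendsto_integral_Iic a hG'i
          (tendsto_atBot_add_const_right _ _ tendsto_id)
      have hI' : Tendsto (fun b : ℝ => 2 * ∫ x in (b + 2 * t)..a, deriv G x ^ 2) atBot (𝓝 IG) := by
        refine hI.congr fun b => ?_
        exact intervalIntegral.integral_const_mul 2 _
      have := ((hI'.div_const ((1 + η) ^ 2)).sub_const (4 * σ ^ 2 * EV / (η * (1 + η)))).sub_const
        (Uq t / η)
      simpa only [hX] using this
    refine le_of_tendsto (ENNReal.tendsto_ofReal hlim) ?_
    filter_upwards [eventually_le_atBot (a - 2 * t)] with b hb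
    have hb' : b + 2 * t ≤ a := by linarith
    have hbt : b + t ≤ a - t := by linarith
    calc ENNReal.ofReal ((2 * ∫ x in (b + 2 * t)..a, deriv G x ^ 2) / (1 + η) ^ 2
          - 4 * σ ^ 2 * EV / (η * (1 + η)) - Uq t / η)
        ≤ ENNReal.ofReal (∫ x in (b + t)..(a - t),
            (deriv (fun τ => ψ τ x) t ^ 2 + deriv (ψ t) x ^ 2 + V x * ψ t x ^ 2)) :=
          ENNReal.ofReal_le_ofReal (hstep t ht b hb')
      _ = ∫⁻ x in Ioc (b + t) (a - t), ENNReal.ofReal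
            (deriv (fun τ => ψ τ x) t ^ 2 + deriv (ψ t) x ^ 2 + V x * ψ t x ^ 2) :=
          (lintegral_Ioc_wave1D_energy_eq hV hV0 hψ t hbt).symm
      _ ≤ ∫⁻ x in Iio (a - |t|), ENNReal.ofReal
            (deriv (fun τ => ψ τ x) t ^ 2 + deriv (ψ t) x ^ 2 + V x * ψ t x ^ 2) := by
          rw [abs_of_nonneg ht, setLIntegral_congr (Iio_ae_eq_Iic (μ := volume) (a := a - t))]
          exact lintegral_mono_set Ioc_subset_Iic_self
  -- STEP 3: `t → +∞`: the static tail `Uq t → 0`, and `liminf` bookkeeping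
  have hUq_tendsto : Tendsto (fun t => Uq t / η) atTop (𝓝 0) := by
    have hat : Tendsto (fun t : ℝ => a - t) atTop atBot :=
      (tendsto_atBot_add_const_left _ a tendsto_neg_atTop_atBot).congr fun t => by ring
    have hT : Tendsto (fun t : ℝ => ∫ x in (a - t)..a, deriv q x ^ 2) atTop
        (𝓝 (∫ x in Iic a, deriv q x ^ 2)) := intervalIntegral_tendsto_integral_Iic a hqi hat
    have hT' := (tendsto_const_nhds (x := ∫ x in Iic a, deriv q x ^ 2)).sub hT
    rw [sub_self] at hT'
    have hU0 : Tendsto Uq atTop (𝓝 0) := by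
      refine hT'.congr' ?_
      filter_upwards [eventually_ge_atTop (0 : ℝ)] with t ht
      have hsub := integral_Iic_sub_Iic (hqi.mono_set (Iic_subset_Iic.2 (by linarith : a - t ≤ a)))
        hqi
      simp only [hUq]
      linarith
    simpa using hU0.div_const η
  calc ENNReal.ofReal ((∫ x in Iic a, (deriv (φ 0) x + deriv (fun τ => φ τ x) 0) ^ 2 / 2) / (1 + η) ^ 2
          - 4 * (2 * Real.sqrt K / μ) ^ 2 * EV / (η * (1 + η)))
        = ENNReal.ofReal X := by rw [hX, hIG_eq]
    _ ≤ _ := ENNReal.ofReal_le_liminf_of_sub_tendsto_zero (U := fun t => Uq t / η) hEn_ge hUq_tendsto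

end Forward

end Literature.Analysis.PDE
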